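import Literature.Geometry.Symplectic.PALFKasFunction
import Literature.Geometry.Symplectic.PALFKasField
import Literature.Topology.FourManifolds.MorseWrittenChart
import Literature.Topology.FourManifolds.MorseSeparateVariablesConverse
import HarnessLib

/-!
# Kas' Morse function on a Lefschetz fibration over the disc: the critical points

Topic `Literature/Geometry/Symplectic` (fact seat
`provefact-Literature.Geometry.Symplectic.Oba2016_s-add47373d4`; Kas 1980 §2 / Lemma 1.6, Gompf–Stipsicz
1999 §8.2).  For the function `G = ‖f - c₀‖² + ε (bb ∘ σ + β(f) · Dfun)` of `PALF.KasSetup`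
(`PALFKasFunction.lean`) this file analyses the critical points away from the boundary collar:

* §1 `mlineDeriv_G_horLift`, `not_isMCriticalPt_of_mem_tube` — **no critical point in the tube
  off the central fibre**: along the horizontal lift `V` of `f x - c₀` one has
  `dG(V) = 2‖f x - c₀‖² + ε Dfun(x) dβ_{f x}(f x - c₀)` (the fibre term and the collar term are
  first integrals of `V`), positive as soon as the bump term is dominated;
* §2 `morseData_incl` — **on the central fibre `G` is a function of separate variables**
  `‖f - c₀‖² + ε m ∘ psiHat`: `incl q` is critical for `G` iff `q` is critical for `m`, and then
  nondegenerate with `index = index_m q` (`Literature.Topology.FourManifolds.morseData_of_separateVariables` with the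
  fibre coordinates of `PALFBoxProduct.lean`, and its first-order converse);
* §3 `not_isMCriticalPt_of_kernelField`, `not_isMCriticalPt_of_flowout` — **off the middle box
  and below the level `2c` there is no critical point** (`dG(ν) = ε bb'(σ) dσ(ν) ≠ 0`, resp.
  `dG(N) = 2⟪f - c₀, df N⟫ + ε bb'(σ) < 0`);
* §4 `morseData_of_mem_crit` — **at a Lefschetz point `G = ‖f - c₀‖² + const` is nondegenerate
  of index `2`** (`IsLefschetzCriticalPoint.isMCriticalPt_nondegenerate_morseIndex_comp`);
  `mem_crit_of_isMCriticalPt_of_le` — off the middle box and above `2c` a critical point of `G`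
  is a critical point of `f`;
* §5 `classification` — every critical point of `G` in `{σ ≥ κ}` is a Lefschetz point or
  `incl q` for a critical point `q` of `m`, given the two exclusion statements of §1 and §3.

## References

* A. Kas, *On the handlebody decomposition associated to a Lefschetz fibration*, Pacific J.
  Math. 89 (1980), §2, Lemma 1.6. [Kas1980]
* R. E. Gompf, A. I. Stipsicz, *4-Manifolds and Kirby Calculus*, GSM 20 (1999), §8.2.
  [GompfStipsiczGSM1999]
* J. Milnor, *Morse theory*, Annals of Mathematics Studies 51 (1963), §2. [Milnor1963]
-/

open scoped Manifold ContDiff Topology RealInnerProductSpace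
open Set Function Filter

noncomputable section

namespace Literature.Geometry.Symplectic

open Literature.Topology.FourManifolds

universe u

variable {W : Type u} [TopologicalSpace W] [ChartedSpace (EuclideanHalfSpace 4) W]
  [IsManifold (𝓡∂ 4) ∞ W]
  {o : SmoothOrientation (𝓡∂ 4) W} {b : BoundaryData (𝓡∂ 4) W (𝓡 3)}
  {P : PALF o b} {D : FlowoutInput 3 W} (S : PALF.KasSetup P D)

namespace PALF

namespace KasSetup

/-! ### §0 Derivatives of the pieces -/

/-- The outer half-width is positive. [folklore] -/
theorem hδ : 0 < S.δ := S.hδ'.trans (S.hδ'δ''.trans S.hδ''δ)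

/-- `bb' = 0` on `[2c, ∞)`. [folklore] -/
theorem deriv_bb_eq_zero {t : ℝ} (ht : 2 * S.c ≤ t) : deriv S.bb t = 0 :=
  deriv_eq_zero_of_forall_ge (S.hbb.differentiable (by simp)) S.hbb_const ht

/-- The derivative of `bb ∘ σ` along a vector. [folklore] -/
theorem mlineDeriv_bb_comp (x : W) (v : EuclideanSpace ℝ (Fin 4)) :
    mlineDeriv (𝓡∂ 4) (fun y => S.bb (D.f y)) x v = deriv S.bb (D.f x) * mlineDeriv (𝓡∂ 4) D.f x v := by
  have hσx : HasMFDerivAt (𝓡∂ 4) 𝓘(ℝ, ℝ) D.f x (mfderiv (𝓡∂ 4) 𝓘(ℝ, ℝ) D.f x) :=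
    ((D.f_smooth x).mdifferentiableAt (by simp)).hasMFDerivAt
  have hb : HasDerivAt S.bb (deriv S.bb (D.f x)) (D.f x) :=
    (S.hbb.differentiable (by simp)).differentiableAt.hasDerivAt
  have h2 : HasMFDerivAt (𝓡∂ 4) 𝓘(ℝ, ℝ) (fun y => S.bb (D.f y)) x
      ((ContinuousLinearMap.smulRight (1 : ℝ →L[ℝ] ℝ) (deriv S.bb (D.f x))).comp
        (mfderiv (𝓡∂ 4) 𝓘(ℝ, ℝ) D.f x)) :=
    hb.hasFDerivAt.hasMFDerivAt.comp x hσx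
  rw [mlineDeriv_def, h2.mfderiv]
  show ((1 : ℝ →L[ℝ] ℝ) (mfderiv (𝓡∂ 4) 𝓘(ℝ, ℝ) D.f x v)) • deriv S.bb (D.f x) = _
  rw [one_apply_eq_self, smul_eq_mul, mlineDeriv_def, mul_comm]

/-- The derivative of `β ∘ f` along a vector. [folklore] -/
theorem mlineDeriv_β_comp (x : W) (v : EuclideanSpace ℝ (Fin 4)) :
    mlineDeriv (𝓡∂ 4) (fun y => S.β (P.f y)) x v =
      fderiv ℝ S.β (P.f x) (mfderiv (𝓡∂ 4) 𝓘(ℝ, EuclideanSpace ℝ (Fin 2)) P.f x v) := by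
  have hf : HasMFDerivAt (𝓡∂ 4) 𝓘(ℝ, EuclideanSpace ℝ (Fin 2)) P.f x
      (mfderiv (𝓡∂ 4) 𝓘(ℝ, EuclideanSpace ℝ (Fin 2)) P.f x) :=
    (P.contMDiff.mdifferentiableAt (by simp)).hasMFDerivAt
  have hβd : HasFDerivAt S.β (fderiv ℝ S.β (P.f x)) (P.f x) :=
    ((S.hβ.differentiable (by simp)).differentiableAt).hasFDerivAt
  have h : HasMFDerivAt (𝓡∂ 4) 𝓘(ℝ, ℝ) (fun y => S.β (P.f y)) x
      ((fderiv ℝ S.β (P.f x)).comp (mfderiv (𝓡∂ 4) 𝓘(ℝ, EuclideanSpace ℝ (Fin 2)) P.f x)) :=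
    hβd.hasMFDerivAt.comp x hf
  rw [mlineDeriv_def]
  exact DFunLike.congr_fun h.mfderiv v

/-! ### §1 The horizontal lift: no critical point in the tube off the central fibre -/

/-- The fibre term along the horizontal lift: `d(Dfun)(V) = -bb'(σ x) dσ(V)` on the tube (the
summand `m ∘ psiHat` is a first integral of `u ↦ Φ (u, Ψ x)`). [cite: Kas1980, §2] -/
theorem mlineDeriv_Dfun_horLift {x : W} (hx : x ∈ S.tube) (w : EuclideanSpace ℝ (Fin 2)) :
    mlineDeriv (𝓡∂ 4) S.Dfun x (S.B.horLift x w) =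
      -(deriv S.bb (D.f x) * mlineDeriv (𝓡∂ 4) D.f x (S.B.horLift x w)) := by
  set q : RegularFibreOn S.hF := ⟨S.B.Ψ x, S.B.Ψ_mem hx.1 hx.2⟩ with hq
  -- `Dfun = m ∘ psiHat - bb ∘ σ` near `x`
  have hev : S.Dfun =ᶠ[𝓝 x] fun y => S.m (S.B.psiHat S.hF q y) - S.bb (D.f y) := by
    filter_upwards [S.isOpen_tube.mem_nhds hx] with y hy using S.Dfun_eq_of_mem hy q
  have hm : MDifferentiableAt (𝓡∂ 4) 𝓘(ℝ, ℝ) (fun y => S.m (S.B.psiHat S.hF q y)) x :=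
    ((S.hm.1.comp_contMDiffOn (S.B.contMDiffOn_psiHat q)).contMDiffAt
      (S.isOpen_tube.mem_nhds hx)).mdifferentiableAt (by simp)
  have hb : MDifferentiableAt (𝓡∂ 4) 𝓘(ℝ, ℝ) (fun y => S.bb (D.f y)) x :=
    ((S.hbb.comp_contMDiff D.f_smooth) x).mdifferentiableAt (by simp)
  -- the fibre summand is a first integral of the horizontal lift
  have h0 : mlineDeriv (𝓡∂ 4) (fun y => S.m (S.B.psiHat S.hF q y)) x (S.B.horLift x w) = 0 := by
    refine S.B.mlineDeriv_horLift_eq_zero hx.1 hm ?_ w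
    filter_upwards [(isOpen_setOf_forall_abs_sub_lt S.c₀ S.δ).mem_nhds hx.1] with u hu
    show S.m (S.B.psiHat S.hF q (S.B.Φ (u, S.B.Ψ x))) = S.m (S.B.psiHat S.hF q x)
    rw [← S.B.incl_psiHat q hx.1 hx.2, S.B.psiHat_Φ q _ hu]
  have hd := hm.hasMFDerivAt.sub hb.hasMFDerivAt
  have e1 : mlineDeriv (𝓡∂ 4) S.Dfun x (S.B.horLift x w) =
      mfderiv (𝓡∂ 4) 𝓘(ℝ, ℝ) (fun y => S.m (S.B.psiHat S.hF q y) - S.bb (D.f y)) x (S.B.horLift x w) :=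
    DFunLike.congr_fun hev.mfderiv_eq (S.B.horLift x w)
  have e2 : mfderiv (𝓡∂ 4) 𝓘(ℝ, ℝ) (fun y => S.m (S.B.psiHat S.hF q y) - S.bb (D.f y)) x (S.B.horLift x w) =
      mlineDeriv (𝓡∂ 4) (fun y => S.m (S.B.psiHat S.hF q y)) x (S.B.horLift x w) -
        mlineDeriv (𝓡∂ 4) (fun y => S.bb (D.f y)) x (S.B.horLift x w) :=
    DFunLike.congr_fun hd.mfderiv (S.B.horLift x w)
  rw [e1, e2, h0, S.mlineDeriv_bb_comp, zero_sub]

/-- The collar coordinate along the horizontal lift is stationary below the level `2c ≤ s₀`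
(`σ ∘ Φ (·, Ψ x)` is constant by the level properties of the product structure). [cite: Kas1980, §2] -/
theorem mlineDeriv_σ_horLift_eq_zero {x : W} (hx : x ∈ S.tube) (hσ : D.f x < 2 * S.c)
    (w : EuclideanSpace ℝ (Fin 2)) :
    mlineDeriv (𝓡∂ 4) D.f x (S.B.horLift x w) = 0 := by
  have hs₀ : D.f x < S.s₀ := lt_of_lt_of_le hσ S.hcs₀
  have hΨ : D.f (S.B.Ψ x) = D.f x := S.hΨlev x hx.1 hs₀
  refine S.B.mlineDeriv_horLift_eq_zero hx.1 ((D.f_smooth x).mdifferentiableAt (by simp)) ?_ w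
  filter_upwards [(isOpen_setOf_forall_abs_sub_lt S.c₀ S.δ).mem_nhds hx.1] with u hu
  rw [S.hΦlev (S.B.Ψ x) (S.B.f_Ψ x hx.1) (by rw [hΨ]; exact hs₀) u hu, hΨ]

/-- **`dG` along the horizontal lift of `f x - c₀`**: on the tube,
`dG(V) = 2‖f x - c₀‖² + ε Dfun(x) · dβ_{f x}(f x - c₀)` — the collar term `bb'(σ) dσ(V)` and
the fibre term drop out (`dσ(V) = 0` below `2c`, `bb' = 0` above). [cite: Kas1980, §2] -/
theorem mlineDeriv_G_horLift {x : W} (hx : x ∈ S.tube) :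
    mlineDeriv (𝓡∂ 4) S.G x (S.B.horLift x (P.f x - S.c₀)) =
      2 * ‖P.f x - S.c₀‖ ^ 2 +
        S.ε * (S.Dfun x * fderiv ℝ S.β (P.f x) (P.f x - S.c₀)) := by
  set V := S.B.horLift x (P.f x - S.c₀) with hV
  have hfV : mfderiv (𝓡∂ 4) 𝓘(ℝ, EuclideanSpace ℝ (Fin 2)) P.f x V = P.f x - S.c₀ :=
    S.B.mfderiv_apply_horLift hx.1 _
  -- the vanishing product `bb'(σ x) dσ(V)`
  have hzero : deriv S.bb (D.f x) * mlineDeriv (𝓡∂ 4) D.f x V = 0 := by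
    rcases lt_or_ge (D.f x) (2 * S.c) with h | h
    · rw [S.mlineDeriv_σ_horLift_eq_zero hx h, mul_zero]
    · rw [S.deriv_bb_eq_zero h, zero_mul]
  -- differentiability of the pieces
  have hG₀d : MDifferentiableAt (𝓡∂ 4) 𝓘(ℝ, ℝ) S.G₀ x := (S.contMDiff_G₀ x).mdifferentiableAt (by simp)
  have hβf : MDifferentiableAt (𝓡∂ 4) 𝓘(ℝ, ℝ) (fun y => S.β (P.f y)) x :=
    ((S.hβ.comp_contMDiff P.contMDiff) x).mdifferentiableAt (by simp)
  have hDd : MDifferentiableAt (𝓡∂ 4) 𝓘(ℝ, ℝ) S.Dfun x :=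
    (S.contMDiffOn_Dfun.contMDiffAt (S.isOpen_tube.mem_nhds hx)).mdifferentiableAt (by simp)
  have hprod := (hβf.hasMFDerivAt.mul hDd.hasMFDerivAt)
  -- `G = G₀ + ε (β ∘ f) Dfun`
  have hGfun : S.G = S.G₀ + S.ε • ((fun y => S.β (P.f y)) * S.Dfun) := by
    funext y; simp only [Pi.add_apply, Pi.smul_apply, Pi.mul_apply, smul_eq_mul]; exact S.G_eq y
  have hGd := hG₀d.hasMFDerivAt.add (hprod.const_smul S.ε)
  rw [← hGfun] at hGd
  have h12 : mlineDeriv (𝓡∂ 4) S.G x V = mlineDeriv (𝓡∂ 4) S.G₀ x V +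
      S.ε * (S.β (P.f x) * mlineDeriv (𝓡∂ 4) S.Dfun x V +
        S.Dfun x * mlineDeriv (𝓡∂ 4) (fun y => S.β (P.f y)) x V) := by
    exact DFunLike.congr_fun hGd.mfderiv V
  have h3 : mlineDeriv (𝓡∂ 4) S.G₀ x V = 2 * ‖P.f x - S.c₀‖ ^ 2 + S.ε * (deriv S.bb (D.f x) * mlineDeriv (𝓡∂ 4) D.f x V) := by
    have h := P.mlineDeriv_nearForm D.f_smooth S.hbb S.c₀ S.ε x V
    rw [hfV, real_inner_self_eq_norm_sq] at h
    exact h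
  rw [h12, h3, S.mlineDeriv_Dfun_horLift hx, S.mlineDeriv_β_comp, hfV, hzero]
  ring

/-- **No critical point in the tube off the central fibre** when the bump term is dominated:
`ε |Dfun(x) dβ_{f x}(f x - c₀)| < 2 ‖f x - c₀‖²` forces `dG(V) > 0`. [cite: Kas1980, §2] -/
theorem not_isMCriticalPt_of_mem_tube {x : W} (hx : x ∈ S.tube)
    (hdom : S.ε * |S.Dfun x * fderiv ℝ S.β (P.f x) (P.f x - S.c₀)| < 2 * ‖P.f x - S.c₀‖ ^ 2) :
    ¬ IsMCriticalPt (𝓡∂ 4) S.G x := by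
  intro hcrit
  unfold IsMCriticalPt at hcrit
  have h2 : (0 : ℝ) = 2 * ‖P.f x - S.c₀‖ ^ 2 + S.ε * (S.Dfun x * fderiv ℝ S.β (P.f x) (P.f x - S.c₀)) := by
    have h := S.mlineDeriv_G_horLift hx
    rw [mlineDeriv_def, hcrit] at h
    exact h
  clear hcrit
  have h5 : S.ε * -(S.Dfun x * fderiv ℝ S.β (P.f x) (P.f x - S.c₀)) ≤
      S.ε * |S.Dfun x * fderiv ℝ S.β (P.f x) (P.f x - S.c₀)| :=
    mul_le_mul_of_nonneg_left (neg_le_abs _) S.hε.le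
  linarith

/-- In the open inner box the bump term vanishes, so the domination hypothesis holds as soon as
`f x ≠ c₀`. [folklore] -/
theorem dom_of_mem_innerBox {x : W} (hx' : ∀ i, |P.f x i - S.c₀ i| < S.δ') (hne : P.f x ≠ S.c₀) :
    S.ε * |S.Dfun x * fderiv ℝ S.β (P.f x) (P.f x - S.c₀)| < 2 * ‖P.f x - S.c₀‖ ^ 2 := by
  have hβ1 : fderiv ℝ S.β (P.f x) = 0 := by
    have hev : S.β =ᶠ[𝓝 (P.f x)] fun _ => 1 := by
      filter_upwards [(isOpen_setOf_forall_abs_sub_lt S.c₀ S.δ').mem_nhds hx'] with u hu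
      exact S.hβ1 u fun i => (hu i).le
    rw [hev.fderiv_eq, fderiv_const_apply]
  rw [hβ1, zero_apply, mul_zero, abs_zero, mul_zero]
  have : 0 < ‖P.f x - S.c₀‖ := norm_pos_iff.2 (sub_ne_zero.2 hne)
  positivity

/-! ### §2 The central fibre: separate variables -/

/-- On the fibre, `Ψ = id` and `psiHat q (incl q) = q`. [folklore] -/
theorem psiHat_incl (q : RegularFibreOn S.hF) :
    S.B.psiHat S.hF q (RegularFibreOn.incl S.hF q) = q := by
  apply Subtype.ext
  show RegularFibreOn.incl S.hF (S.B.psiHat S.hF q (RegularFibreOn.incl S.hF q)) = RegularFibreOn.incl S.hF q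
  rw [S.B.incl_psiHat q (x := RegularFibreOn.incl S.hF q) ?_ (RegularFibreOn.isInteriorPoint_incl S.hF q),
    S.B.Ψ_eq_self S.hδ (RegularFibreOn.apply_incl S.hF q)]
  intro i
  rw [RegularFibreOn.apply_incl S.hF q, sub_self, abs_zero]; exact S.hδ

/-- Points of the fibre lie in the tube and in the inner box. [folklore] -/
theorem incl_mem_tube (q : RegularFibreOn S.hF) : RegularFibreOn.incl S.hF q ∈ S.tube :=
  ⟨fun i => by rw [RegularFibreOn.apply_incl S.hF q, sub_self, abs_zero]; exact S.hδ,
    RegularFibreOn.isInteriorPoint_incl S.hF q⟩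

/-- **Morse data of `G` on the central fibre** (Kas 1980 §2; Milnor 1963 §2: a function of
separate variables in the product chart).  For `q ∈ F°` and `x = incl q`:
`x` is critical for `G` iff `q` is critical for `m`; and if so, the Hessian of `G` at `x` is
nondegenerate with `index_x G = index_q m` (`G = ‖f - c₀‖² + ε m ∘ psiHat` near `x`, the base
term nondegenerate of index `0` at `c₀`, the fibre term `ε m ∘ chart⁻¹`).
[cite: Kas1980, §2] [cite: Milnor1963, §2] -/
theorem morseData_incl (q : RegularFibreOn S.hF) :
    (IsMCriticalPt (𝓡∂ 4) S.G (RegularFibreOn.incl S.hF q) ↔ IsMCriticalPt (𝓡 2) S.m q) ∧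
      (IsMCriticalPt (𝓡 2) S.m q →
        (mhessian (𝓡∂ 4) S.G (RegularFibreOn.incl S.hF q)).Nondegenerate ∧
          morseIndex (𝓡∂ 4) S.G (RegularFibreOn.incl S.hF q) = morseIndex (𝓡 2) S.m q) := by
  set x := RegularFibreOn.incl S.hF q with hx
  have hxT : x ∈ S.tube := S.incl_mem_tube q
  have hq : q = S.B.psiHat S.hF q x := (S.psiHat_incl q).symm
  have hfx : P.f x = S.c₀ := RegularFibreOn.apply_incl S.hF q
  -- the separated form
  set e := extChartAt (𝓡 2) q with he
  set α : EuclideanSpace ℝ (Fin 2) → ℝ := fun u => ‖u - S.c₀‖ ^ 2 with hα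
  set βf : EuclideanSpace ℝ (Fin 2) → ℝ := fun v => S.ε * S.m (e.symm v) with hβf
  set s : Set W := (S.tube) ∩ S.B.psiHat S.hF q ⁻¹' (chartAt (EuclideanSpace ℝ (Fin 2)) q).source with hs
  have hso : IsOpen s := S.B.isOpen_fibreCoordSource q
  have hxs : x ∈ s := ⟨hxT, by
    show S.B.psiHat S.hF q x ∈ (chartAt (EuclideanSpace ℝ (Fin 2)) q).source
    rw [← hq]; exact mem_chart_source (EuclideanSpace ℝ (Fin 2)) q⟩
  have hFev : S.G =ᶠ[𝓝 x] fun y => α (P.f y) + βf (S.B.fibreCoord S.hF q y) := by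
    have h1 := S.G_eventuallyEq_separated hxT (fun i => by
      rw [hfx, sub_self, abs_zero]; exact S.hδ') q
    filter_upwards [h1, hso.mem_nhds hxs] with y hy hys
    rw [hy]
    show ‖P.f y - S.c₀‖ ^ 2 + S.ε * S.m (S.B.psiHat S.hF q y) =
      ‖P.f y - S.c₀‖ ^ 2 + S.ε * S.m (e.symm (e (S.B.psiHat S.hF q y)))
    rw [e.left_inv (by rw [he, extChartAt_source]; exact hys.2)]
  have hbij := S.B.bijective_mfderiv_fibreCoord hxT.1 hxT.2 q hq
  have hg₁ : ContMDiffOn (𝓡∂ 4) 𝓘(ℝ, EuclideanSpace ℝ (Fin 2)) ∞ P.f s := P.contMDiff.contMDiffOn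
  have hg₂ : ContMDiffOn (𝓡∂ 4) 𝓘(ℝ, EuclideanSpace ℝ (Fin 2)) ∞ (S.B.fibreCoord S.hF q) s :=
    S.B.contMDiffOn_fibreCoord q
  have hαs : ContDiff ℝ ∞ α := (contDiff_norm_sq ℝ).comp (contDiff_id.sub contDiff_const)
  -- the fibre term read in the chart of `F°` at `q`
  have hms : ContMDiff (𝓡 2) 𝓘(ℝ, ℝ) ∞ S.m := S.hm.1
  have hqint : (𝓡 2).IsInteriorPoint q := BoundarylessManifold.isInteriorPoint
  have hme : ContDiffAt ℝ ∞ (S.m ∘ e.symm) (e q) := by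
    have h := ((contMDiffOn_extChartAt_symm (I := 𝓡 2) (n := ∞) q).contMDiffAt
      ((isOpen_extChartAt_target (I := 𝓡 2) q).mem_nhds (mem_extChartAt_target (I := 𝓡 2) q)))
    exact (hms.contMDiffAt.comp (e q) (by rw [he]; exact h)).contDiffAt
  have hβfs : ContDiffAt ℝ ∞ βf (e q) := contDiffAt_const.mul hme
  have hg₂x : S.B.fibreCoord S.hF q x = e q := by
    show extChartAt (𝓡 2) q (S.B.psiHat S.hF q x) = e q; rw [← hq]
  -- Morse data of `βf` at `e q` versus `m` at `q`
  have hmq : MDifferentiableAt (𝓡 2) 𝓘(ℝ, ℝ) S.m q := hms.mdifferentiableAt (by simp)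
  have hcritβ : IsMCriticalPt 𝓘(ℝ, EuclideanSpace ℝ (Fin 2)) βf (e q) ↔ IsMCriticalPt (𝓡 2) S.m q := by
    rw [isMCriticalPt_iff_comp_symm (I := 𝓡 2) hqint hmq]
    show IsMCriticalPt 𝓘(ℝ, EuclideanSpace ℝ (Fin 2)) (fun v => S.ε * S.m (e.symm v)) (e q) ↔
      IsMCriticalPt 𝓘(ℝ, EuclideanSpace ℝ (Fin 2)) (S.m ∘ e.symm) (e q)
    have hd : HasDerivAt (fun t : ℝ => S.ε * t) S.ε ((S.m ∘ e.symm) (e q)) := by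
      simpa using (hasDerivAt_id ((S.m ∘ e.symm) (e q))).const_mul S.ε
    exact isMCriticalPt_comp_iff_of_hasDerivAt (σ := fun t => S.ε * t) (g := S.m ∘ e.symm) hd S.hε.ne'
      ((hme.differentiableAt (by simp)).mdifferentiableAt)
  -- apply the separate-variables lemmas
  have hα1 : IsMCriticalPt 𝓘(ℝ, EuclideanSpace ℝ (Fin 2)) α (P.f x) := by
    rw [hfx]; exact isMCriticalPt_normSqSub S.c₀
  refine ⟨⟨fun hG => ?_, fun hm => ?_⟩, fun hm => ?_⟩
  · -- `G` critical ⇒ `m` critical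
    have hsurj : Surjective (mfderiv (𝓡∂ 4) 𝓘(ℝ, EuclideanSpace ℝ (Fin 2)) (S.B.fibreCoord S.hF q) x) :=
      fun w => by obtain ⟨v, hv⟩ := hbij.2 (0, w); exact ⟨v, (Prod.ext_iff.1 hv).2⟩
    have h := isMCriticalPt_of_separateVariables_of_surjective (I := 𝓡∂ 4)
      ((hg₁.contMDiffAt (hso.mem_nhds hxs)).mdifferentiableAt (by simp))
      ((hg₂.contMDiffAt (hso.mem_nhds hxs)).mdifferentiableAt (by simp)) hsurj
      (hαs.differentiable (by simp)).differentiableAt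
      (by rw [hg₂x]; exact hβfs.differentiableAt (by simp)) hFev hα1 hG
    rw [hg₂x] at h
    exact hcritβ.1 h
  · -- `m` critical ⇒ `G` critical
    have hβ1 : IsMCriticalPt 𝓘(ℝ, EuclideanSpace ℝ (Fin 2)) βf (S.B.fibreCoord S.hF q x) := by
      rw [hg₂x]; exact hcritβ.2 hm
    exact (morseData_of_separateVariables (show 2 + 2 = 4 from rfl) hso hxs hxT.2 hg₁ hg₂ hbij
      ((hαs.of_le (by norm_cast)).contDiffAt) (by rw [hg₂x]; exact hβfs.of_le (by norm_cast)) hFev hα1 hβ1).1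
  · -- nondegeneracy and index
    have hβ1 : IsMCriticalPt 𝓘(ℝ, EuclideanSpace ℝ (Fin 2)) βf (S.B.fibreCoord S.hF q x) := by
      rw [hg₂x]; exact hcritβ.2 hm
    have hdata := (morseData_of_separateVariables (show 2 + 2 = 4 from rfl) hso hxs hxT.2 hg₁ hg₂ hbij
      ((hαs.of_le (by norm_cast)).contDiffAt) (by rw [hg₂x]; exact hβfs.of_le (by norm_cast)) hFev hα1 hβ1).2
    -- the fibre Hessian: `βf = (ε ·) ∘ (m ∘ e⁻¹)`
    have hmcrit' : IsMCriticalPt 𝓘(ℝ, EuclideanSpace ℝ (Fin 2)) (S.m ∘ e.symm) (e q) :=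
      (isMCriticalPt_iff_comp_symm (I := 𝓡 2) hqint hmq).1 hm
    have hme2 : ContMDiffAt 𝓘(ℝ, EuclideanSpace ℝ (Fin 2)) 𝓘(ℝ, ℝ) 2 (S.m ∘ e.symm) (e q) :=
      ((hme.of_le (by norm_cast)).contMDiffAt)
    have hφ : ContDiffAt ℝ 2 (fun t : ℝ => S.ε * t) ((S.m ∘ e.symm) (e q)) := (contDiff_const.mul contDiff_id).contDiffAt
    have hφ' : deriv (fun t : ℝ => S.ε * t) ((S.m ∘ e.symm) (e q)) = S.ε := by
      simp
    have hnd : (mhessian 𝓘(ℝ, EuclideanSpace ℝ (Fin 2)) βf (e q)).Nondegenerate ↔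
        (mhessian (𝓡 2) S.m q).Nondegenerate := by
      rw [mhessian_eq_mhessian_comp_symm (I := 𝓡 2) hqint]
      have h := nondegenerate_mhessian_real_comp_iff (I := 𝓘(ℝ, EuclideanSpace ℝ (Fin 2)))
        (f := S.m ∘ e.symm) (φ := fun t => S.ε * t) BoundarylessManifold.isInteriorPoint hme2 hφ hmcrit'
        (by rw [hφ']; exact S.hε.ne')
      exact h
    have hidx : morseIndex 𝓘(ℝ, EuclideanSpace ℝ (Fin 2)) βf (e q) = morseIndex (𝓡 2) S.m q := by
      rw [morseIndex_eq_morseIndex_comp_symm (I := 𝓡 2) hqint]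
      exact morseIndex_real_comp_eq (I := 𝓘(ℝ, EuclideanSpace ℝ (Fin 2))) (f := S.m ∘ e.symm)
        (φ := fun t => S.ε * t) BoundarylessManifold.isInteriorPoint hme2 hφ hmcrit' (by rw [hφ']; exact S.hε)
    have hαnd : (mhessian 𝓘(ℝ, EuclideanSpace ℝ (Fin 2)) α (P.f x)).Nondegenerate :=
      nondegenerate_mhessian_normSqSub S.c₀ _
    have hβnd : (mhessian 𝓘(ℝ, EuclideanSpace ℝ (Fin 2)) βf (S.B.fibreCoord S.hF q x)).Nondegenerate := by
      rw [hg₂x]; exact hnd.2 (S.hm.2 q hm)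
    obtain ⟨hGnd, hGidx⟩ := hdata hαnd hβnd
    refine ⟨hGnd, ?_⟩
    rw [hGidx, hg₂x, hidx, hfx, morseIndex_normSqSub, zero_add]

/-! ### §3 Off the middle box, below the level `2c` -/

/-- **No critical point off the middle box below `2c`, via the kernel field**: if
`df(ν x) = 0`, `dσ(ν x) > 0`, `bb'(σ x) < 0` then `dG(ν x) = ε bb'(σ x) dσ(ν x) < 0`.
[cite: Kas1980, §2] -/
theorem not_isMCriticalPt_of_kernelField {x : W} (hx : ∃ i, S.δ'' < |P.f x i - S.c₀ i|)
    {v : EuclideanSpace ℝ (Fin 4)} (hvk : mfderiv (𝓡∂ 4) 𝓘(ℝ, EuclideanSpace ℝ (Fin 2)) P.f x v = 0)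
    (hvσ : 0 < mlineDeriv (𝓡∂ 4) D.f x v) (hbb' : deriv S.bb (D.f x) < 0) :
    ¬ IsMCriticalPt (𝓡∂ 4) S.G x := by
  intro hcrit
  have hev := S.G_eventuallyEq_G₀_of_not_mem hx
  have h1 : mlineDeriv (𝓡∂ 4) S.G x v = mlineDeriv (𝓡∂ 4) S.G₀ x v := by
    simp only [mlineDeriv_def]; exact DFunLike.congr_fun hev.mfderiv_eq v
  have h2 := P.mlineDeriv_nearForm D.f_smooth S.hbb S.c₀ S.ε x v
  have h0 : ⟪P.f x - S.c₀, mfderiv (𝓡∂ 4) 𝓘(ℝ, EuclideanSpace ℝ (Fin 2)) P.f x v⟫ = 0 :=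
    (congrArg _ hvk).trans (inner_zero_right _)
  rw [h0, mul_zero, zero_add] at h2
  unfold IsMCriticalPt at hcrit
  rw [mlineDeriv_def, hcrit, zero_apply] at h1
  have h3 : (0 : ℝ) = S.ε * (deriv S.bb (D.f x) * mlineDeriv (𝓡∂ 4) D.f x v) := h1.trans h2
  have h4 : deriv S.bb (D.f x) * mlineDeriv (𝓡∂ 4) D.f x v < 0 := mul_neg_of_neg_of_pos hbb' hvσ
  nlinarith [S.hε]

/-- **No critical point off the middle box below `2c`, via the flow-out field**: if
`⟪f x - c₀, df(N x)⟫ < 0`, `dσ(N x) = 1`, `bb'(σ x) < 0` then `dG(N x) < 0`. [cite: Kas1980, §2] -/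
theorem not_isMCriticalPt_of_flowout {x : W} (hx : ∃ i, S.δ'' < |P.f x i - S.c₀ i|)
    (hvert : ⟪P.f x - S.c₀, mfderiv (𝓡∂ 4) 𝓘(ℝ, EuclideanSpace ℝ (Fin 2)) P.f x (D.ξ x)⟫ < 0)
    (hσ : D.f x ≤ D.δ) (hbb' : deriv S.bb (D.f x) < 0) :
    ¬ IsMCriticalPt (𝓡∂ 4) S.G x := by
  intro hcrit
  have hev := S.G_eventuallyEq_G₀_of_not_mem hx
  have h1 : mlineDeriv (𝓡∂ 4) S.G x (D.ξ x) = mlineDeriv (𝓡∂ 4) S.G₀ x (D.ξ x) := by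
    simp only [mlineDeriv_def]; exact DFunLike.congr_fun hev.mfderiv_eq (D.ξ x)
  have h2 := P.mlineDeriv_nearForm D.f_smooth S.hbb S.c₀ S.ε x (D.ξ x)
  rw [D.mlineDeriv_f_ξ x hσ, mul_one] at h2
  unfold IsMCriticalPt at hcrit
  rw [mlineDeriv_def, hcrit, zero_apply] at h1
  have h3 : (0 : ℝ) = 2 * ⟪P.f x - S.c₀, mfderiv (𝓡∂ 4) 𝓘(ℝ, EuclideanSpace ℝ (Fin 2)) P.f x (D.ξ x)⟫ +
      S.ε * deriv S.bb (D.f x) := h1.trans h2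
  nlinarith [S.hε]

/-! ### §4 Lefschetz points and the region above `2c` -/

/-- **Above `2c`, off the middle box, a critical point of `G` is a critical point of `f`**:
there `dG_x = 2⟪f x - c₀, df_x ·⟫` (`bb'(σ x) = 0`) with `f x ≠ c₀`, so `df_x` is not onto.
[cite: Kas1980, §2] -/
theorem mem_crit_of_isMCriticalPt_of_le {x : W} (hx : ∃ i, S.δ'' < |P.f x i - S.c₀ i|)
    (hσ : 2 * S.c ≤ D.f x) (hcrit : IsMCriticalPt (𝓡∂ 4) S.G x) : x ∈ P.crit := by
  by_contra hxc
  have hne : P.f x - S.c₀ ≠ 0 := by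
    obtain ⟨i, hi⟩ := hx
    intro h
    have : P.f x i - S.c₀ i = 0 := by
      have := congrArg (fun u : EuclideanSpace ℝ (Fin 2) => u i) h
      simpa using this
    rw [this, abs_zero] at hi
    linarith [S.hδ'.trans S.hδ'δ'']
  obtain ⟨v, hv⟩ := P.submersion x hxc (P.f x - S.c₀)
  have hev := S.G_eventuallyEq_G₀_of_not_mem hx
  have h1 : mlineDeriv (𝓡∂ 4) S.G x v = mlineDeriv (𝓡∂ 4) S.G₀ x v := by
    simp only [mlineDeriv_def]; exact DFunLike.congr_fun hev.mfderiv_eq v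
  have h2 := P.mlineDeriv_nearForm D.f_smooth S.hbb S.c₀ S.ε x v
  rw [hv, real_inner_self_eq_norm_sq, S.deriv_bb_eq_zero hσ, zero_mul, mul_zero, add_zero] at h2
  unfold IsMCriticalPt at hcrit
  rw [mlineDeriv_def, hcrit, zero_apply] at h1
  have h3 : (0 : ℝ) = 2 * ‖P.f x - S.c₀‖ ^ 2 := h1.trans h2
  have h4 : 0 < ‖P.f x - S.c₀‖ := norm_pos_iff.2 hne
  nlinarith

/-- **Morse data at a Lefschetz point** (Kas 1980, Lemma 1.6): at `p ∈ crit f` with `σ p > 2c`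
and `f p` off the middle box, `G = ‖f - c₀‖² + ε bb(2c)` near `p` is a height function
`ℓ ∘ f` plus a constant, with `dℓ_{f p} = 2⟪f p - c₀, ·⟫ ≠ 0`; so `p` is a nondegenerate
critical point of `G` of index `2`. [cite: Kas1980, Lemma 1.6] [cite: Milnor1963, §2] -/
theorem morseData_of_mem_crit {p : W} (hp : p ∈ P.crit) (hpbox : ∃ i, S.δ'' < |P.f p i - S.c₀ i|)
    (hσ : 2 * S.c < D.f p) :
    IsMCriticalPt (𝓡∂ 4) S.G p ∧ (mhessian (𝓡∂ 4) S.G p).Nondegenerate ∧ morseIndex (𝓡∂ 4) S.G p = 2 := by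
  set ℓ : EuclideanSpace ℝ (Fin 2) → ℝ := fun u => ‖u - S.c₀‖ ^ 2 with hℓ
  -- `G = ℓ ∘ f + ε bb(2c)` near `p`
  have hev : S.G =ᶠ[𝓝 p] fun y => (ℓ ∘ P.f) y + S.ε * S.bb (2 * S.c) := by
    have h1 := S.G_eventuallyEq_G₀_of_not_mem hpbox
    have h2 : D.f ⁻¹' Ioi (2 * S.c) ∈ 𝓝 p :=
      D.f_smooth.continuous.continuousAt.preimage_mem_nhds (Ioi_mem_nhds hσ)
    filter_upwards [h1, h2] with y hy hy2
    rw [hy]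
    show ‖P.f y - S.c₀‖ ^ 2 + S.ε * S.bb (D.f y) = ‖P.f y - S.c₀‖ ^ 2 + S.ε * S.bb (2 * S.c)
    rw [S.hbb_const (D.f y) (le_of_lt hy2)]
  -- the height function `ℓ` has nonzero differential at `f p ≠ c₀`
  have hne : P.f p - S.c₀ ≠ 0 := by
    obtain ⟨i, hi⟩ := hpbox
    intro h
    have : P.f p i - S.c₀ i = 0 := by
      have := congrArg (fun u : EuclideanSpace ℝ (Fin 2) => u i) h
      simpa using this
    rw [this, abs_zero] at hi
    linarith [S.hδ'.trans S.hδ'δ'']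
  have hℓs : ContDiff ℝ ∞ ℓ := (contDiff_norm_sq ℝ).comp (contDiff_id.sub contDiff_const)
  have hℓ' : mfderiv 𝓘(ℝ, EuclideanSpace ℝ (Fin 2)) 𝓘(ℝ, ℝ) ℓ (P.f p) ≠ 0 := by
    intro h
    have e1 : fderiv ℝ ℓ (P.f p) (P.f p - S.c₀) = 2 * ‖P.f p - S.c₀‖ ^ 2 := by
      rw [hℓ, fderiv_normSqSub]
      simp only [smul_apply, innerSL_apply_apply, real_inner_self_eq_norm_sq, smul_eq_mul]
    have e2 : mfderiv 𝓘(ℝ, EuclideanSpace ℝ (Fin 2)) 𝓘(ℝ, ℝ) ℓ (P.f p) (P.f p - S.c₀) =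
        fderiv ℝ ℓ (P.f p) (P.f p - S.c₀) :=
      DFunLike.congr_fun (mfderiv_eq_fderiv (f := ℓ) (x := P.f p)) (P.f p - S.c₀)
    have key : (2 : ℝ) * ‖P.f p - S.c₀‖ ^ 2 = 0 := by
      rw [← e1, ← e2, h]; rfl
    have h4 : 0 < ‖P.f p - S.c₀‖ := norm_pos_iff.2 hne
    nlinarith
  obtain ⟨hc, hnd, hidx⟩ := (P.lefschetz p hp).isMCriticalPt_nondegenerate_morseIndex_comp
    hℓs.contMDiff.contMDiffAt hℓ'
  refine ⟨(isMCriticalPt_congr_of_eventuallyEq_add_const hev).2 hc, ?_, ?_⟩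
  · rw [mhessian_congr_of_eventuallyEq_add_const hev]; exact hnd
  · unfold morseIndex at hidx ⊢
    rw [mhessian_congr_of_eventuallyEq_add_const hev]; exact hidx

/-! ### §5 Classification of the critical points above the level `κ` -/

/-- **Classification.**  Suppose that (i) no point of the tube off the central fibre and
(ii) no point off the middle box below the level `2c` is critical for `G` (the conclusions of
§1 and §3 under the quantitative hypotheses of the assembly).  Then every critical point `x` of
`G` in the interior is a Lefschetz critical point of `f` or a point `incl q` of the central
fibre with `q` critical for `m` (Kas 1980, §2). [cite: Kas1980, §2] -/
theorem classification
    (htube : ∀ x ∈ S.tube, P.f x ≠ S.c₀ → ¬ IsMCriticalPt (𝓡∂ 4) S.G x)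
    (hoff : ∀ x, (∃ i, S.δ'' < |P.f x i - S.c₀ i|) → D.f x < 2 * S.c → ¬ IsMCriticalPt (𝓡∂ 4) S.G x)
    (hmid : ∀ x, (∀ i, |P.f x i - S.c₀ i| < S.δ) ∨ ∃ i, S.δ'' < |P.f x i - S.c₀ i|)
    {x : W} (hxi : (𝓡∂ 4).IsInteriorPoint x) (hcrit : IsMCriticalPt (𝓡∂ 4) S.G x) :
    x ∈ P.crit ∨ ∃ q : RegularFibreOn S.hF, RegularFibreOn.incl S.hF q = x ∧ IsMCriticalPt (𝓡 2) S.m q := by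
  rcases hmid x with hbox | hout
  · -- in the tube: on the central fibre
    have hxT : x ∈ S.tube := ⟨hbox, hxi⟩
    have hfx : P.f x = S.c₀ := by
      by_contra h; exact htube x hxT h hcrit
    refine Or.inr ⟨⟨x, ⟨hfx, hxi⟩⟩, rfl, ?_⟩
    exact (S.morseData_incl ⟨x, ⟨hfx, hxi⟩⟩).1.1 hcrit
  · -- off the middle box
    rcases lt_or_ge (D.f x) (2 * S.c) with hσ | hσ
    · exact absurd hcrit (hoff x hout hσ)
    · exact Or.inl (S.mem_crit_of_isMCriticalPt_of_le hout hσ hcrit)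

end KasSetup

end PALF

end Literature.Geometry.Symplectic

end
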